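import Literature.MathematicalPhysics.QuantumFieldTheory.Balaban1983to89.B13Lemma1DepGather
import Literature.MathematicalPhysics.QuantumFieldTheory.Balaban1983to89.B13Lemma1TorusFull

/-!
# `Balaban1983to89.B13Lemma1DepTorus` — T. Bałaban, *Renormalization group approach to lattice gauge field theories.
II. Cluster expansions*, Commun. Math. Phys. **116** (1988) 1–22, doi:10.1007/bf01239022 [Balaban1988RG2Cluster]:
**Lemma 1 (1.33)–(1.36) p. 9 on the two-scale torus, RE-ASSEMBLED over the □₀-dependent bookkeeping** — the cubes
□′ ∈ π_j live on the scale-j torus of the TOWER `TPt 4 (L^{k−j}·(L·N′))` (L^{k−j} = (L^jη)⁻¹ cubes of π_j per cube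
of π_k and direction), the families {□′}, {X ∋ □′} depend on □₀ resp. □ as in print, X₀ := the π_k-blocks met by X
(`tcoarse`), and EVERY statement about tree lengths and cube numbers at every scale is a theorem of the torus:
G1 ∕ G1′ (`B13Lemma1Torus.g1_torus`), the outer inequality of (1.28) (`outer128_torus`), the □-count
(`card_le_mul_exp_torus`), (1.26) at both rates (`TreeLengthTorus.ineq126_torus`), (1.31) (`B13Lemma1TorusFull.ineq131_torus`),
M⁻⁴|Y∖X₀| := #(Y∖X₀)

statement-level skeleton of published theorems with citation tags; proofs where landed; nothing here is a claim about
the Yang–Mills mass gap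

PDF held: `paper:balaban1988-cmp116-rg-ii-cluster` (journal page = PDF page + 0); pp. 7–9 re-read this session as
images (`b2b-balaban-ref1/pages/…-p008-x2.png`, `…-p009-x2.png`) and from the text layer.

CITATION HEADER / WHAT IS REPRODUCED (cell `pub-ymgap`, Track A node N10 = [B13], prover seat `pub-ymgap-dag-p2`, eighth
module; a NEW LEAF over `B13Lemma1DepGather` and `B13Lemma1TorusFull` (p404321), nothing there modified).  p. 7 [PDF 7]:
*"Now we consider the sum of all terms (1.23) having the same localization domain Y. It is a sum over all admissible
□₀, Y₀, j and X."*; p. 8 [PDF 8]: *"We take X ∈ 𝐃_j, X ⊂ □̃². … the first is over □′ ∈ π_j, □′ ⊂ □̃², the second over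
X ∈ 𝐃_j such that □′ ⊂ X"*; p. 8 (after (1.29)): *"where X₀ is the smallest localization domain from 𝐃_k containing
X"*; (1.30)–(1.32) p. 9.
* `sum_exp_above_le` — (1.26) on any torus of M-cubes (`ineq126_torus` BY NAME, O(1) = K₀(64, 8), t ≥ κ₀(64, 8)), and
  `sum_exp_sub_le` — the same over any sub-family of the X ∋ □′.
* `lemma1Printed_twoTorus_dep` — `B13.Lemma1Printed W.toStepData c` for `W : TwoTorusStep 4 L N′` from: the
  decomposition (1.33) of V′_k(Y) into the two Y-sums with □₀-DEPENDENT families (□′ ∈ `Sq Y □₀ j` ⊂ π_j of the scale-j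
  torus, X ∈ `SX Y □₀ j □′` ⊆ the 𝐃_j-domains containing □′ = `(tcubeSys 4 _).above □′` — print: the X ⊂ □̃²; for the
  (I.3.7) chain X ∈ `SX' Y □ j □′` ⊆ the X ∋ □′, each with X₀ ⊆ Y, `hX0`), per-term analyticity (p. 7, p. 9) with the closure of `W.Analytic` ([folklore]), the per-term bounds (1.24)
  (`h124`) and (1.30) (`h130`, with M⁻⁴|Y∖X₀| THE NUMBER #(Y∖X₀)) VERBATIM — by reference in print to (I.3.54),
  (I.3.17), [15] Prop. 4, [13] (3.108) —, the □₀-data of [I]'s geometry (block ⊆ Y with ≥ 80 cubes and d_k ≤ d₀,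
  N ≥ #(Y∖□₀), N ≥ #W, #F ≤ 8·12³, #{□₀} ≤ M⁻⁴|Y| — made concrete in the sibling block-geometry module), the counts
  «(6L)⁴L^jη» (`hq`, per □₀) and the scale-honest □′-sum `O₂·(L^jη)⁻⁴` (`hq'`), #{□} ≤ M⁻⁴|Y|, the thresholds
  (κ, δκ ≥ κ₀(64, 8); κ₁ ≥ 1 + 2 log(8·12³), 2 + 16 log 128; δ₀M ≥ 10e⁻¹; δκ ≥ 1; L ≥ 2), R8, R9 and the choice of
  the constants of (1.36) (`hC`).  PROVED inside: G1, (1.25), (1.26)×2, (1.27), (1.28) outer, (1.29), (1.31), G1′,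
  (1.32), the factor (L^jη)⁵, the j-sums, the □-count 64e^{δκd_k(Y)}, the p. 9 gathering, R9 ⇒ (1.36), analyticity
  of V′_k.  L here is the torus block number = the L of record (NODE 00 pins them equal).
HONEST FRAMING: a count-neutral Track-A side landing (YM-PLAN §1); NOT a discharge of node N10 (B13 group FREE at NODE
00 Stages 1–3); one finite T⁴ programme at fixed ε; Bałaban AS PRINTED with page locators; nothing continuum / OS /
mass-gap / Clay.
-/

noncomputable section

namespace Literature.MathematicalPhysics.QuantumFieldTheory.Balaban1983to89.B13Lemma1DepTorus

open Literature.MathematicalPhysics.QuantumFieldTheory.Balaban1983to89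
open Literature.MathematicalPhysics.QuantumFieldTheory.Balaban1983to89.TreeLengthTorus
open Literature.MathematicalPhysics.QuantumFieldTheory.Balaban1983to89.TreeLengthTorusTransfer (tcoarse)
open Literature.MathematicalPhysics.QuantumFieldTheory.Balaban1983to89.B12TreeDecay (kappa₀ K₀ K₀_pos)
open Literature.MathematicalPhysics.QuantumFieldTheory.Balaban1983to89.B13Lemma3Torus (TwoTorusStep)
open Literature.MathematicalPhysics.QuantumFieldTheory.Balaban1983to89.B13Lemma1Torus
  (g1_torus outer128_torus card_le_mul_exp_torus)
open Literature.MathematicalPhysics.QuantumFieldTheory.Balaban1983to89.B13Lemma1TorusFull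
  (ineq131_torus isTDom_image_tcoarse)
open Literature.MathematicalPhysics.QuantumFieldTheory.Balaban1983to89.B13Lemma1DepGather
  (gather_129_dep gather_p9_dep)

/-! ## §0. Finite sums of analytic functions (the silent step of p. 9) -/

/-- Closure of an abstract analyticity predicate under finite sums (p. 9: *"all the terms are defined and analytic on
it"* ⇒ V′_k analytic).  Private kernel plumbing. [folklore] -/
private theorem analytic_finset_sum {Φ : Type*} (An : (Φ → ℂ) → Set Φ → Prop) (s : Set Φ)
    (hAdd : ∀ f g, An f s → An g s → An (f + g) s) (hZero : An 0 s) {ι : Type*} (I : Finset ι)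
    (f : ι → Φ → ℂ) (h : ∀ i ∈ I, An (f i) s) : An (∑ i ∈ I, f i) s :=
  Finset.sum_induction f (fun g => An g s) (fun a b ha hb => hAdd a b ha hb) hZero h

/-! ## §1. (1.26) on a torus of M-cubes, over the X ∋ □′ and over any sub-family -/

/-- **(1.26) p. 8 on a torus with `Nj` cubes of π_j per direction** (*"Σ_{X∈𝐃_j, X⊃□′} exp(−κd_j(X)) ≤ O(1), (1.26)
for κ sufficiently large"*): Σ over the torus localization domains X ∋ □′ of exp(−t·d_j(X)) ≤ K₀(64, 8) for every
t ≥ κ₀(64, 8) — `TreeLengthTorus.ineq126_torus` BY NAME. [cite: Balaban1988RG2Cluster, (1.26) p.8] -/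
theorem sum_exp_above_le (Nj : ℕ) [NeZero Nj] {t : ℝ} (ht : kappa₀ 64 8 ≤ t) (q : TPt 4 Nj) :
    ∑ x ∈ (tcubeSys 4 Nj).above q, Real.exp (-(t * torusTreeLen x.1)) ≤ K₀ 64 8 := by
  have hκ : kappa₀ (4 * 2 ^ 4) (2 * 4) ≤ t := by norm_num; exact ht
  have h := ineq126_torus 4 Nj hκ q
  have hK : K₀ (4 * 2 ^ 4) (2 * 4) = K₀ 64 8 := by norm_num
  rw [hK] at h
  refine le_of_eq_of_le (Finset.sum_congr rfl fun X _ => ?_) h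
  rw [tsys_dj, neg_mul]

/-- (1.26) over any SUB-FAMILY of the X ∋ □′ (the terms are positive; print sums over the X ⊂ □̃², resp. the X
with their chosen □′). [cite: Balaban1988RG2Cluster, (1.26) p.8] -/
theorem sum_exp_sub_le (Nj : ℕ) [NeZero Nj] {t : ℝ} (ht : kappa₀ 64 8 ≤ t) (q : TPt 4 Nj)
    {S : Finset (TDom 4 Nj)} (hS : S ⊆ (tcubeSys 4 Nj).above q) :
    ∑ x ∈ S, Real.exp (-(t * torusTreeLen x.1)) ≤ K₀ 64 8 :=
  (Finset.sum_le_sum_of_subset_of_nonneg hS fun _ _ _ => (Real.exp_pos _).le).trans (sum_exp_above_le Nj ht q)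

/-! ## §2. Lemma 1 on the two-scale torus over the tower, □₀-dependent families -/

section Torus

variable {L N' : ℕ} [NeZero L] [NeZero N']

/-- **LEMMA 1 (1.33)–(1.36) p. 9 ON THE TWO-SCALE TORUS, □₀-DEPENDENT FAMILIES, TOWER OF TORI.**  For
`W : TwoTorusStep 4 L N′` (𝐃_k = `tsys 4 (L·N′)`, π_j = `TPt 4 (L^{k−j}·(L·N′))`, 𝐃_j = `TDom 4 (L^{k−j}·(L·N′))`):
`B13.Lemma1Printed W.toStepData c` GIVEN (a) the decomposition (1.33) of V′_k(Y) into the Y-sum of the terms (1.23) —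
over □₀ ∈ `S0 Y`, Y₀ ↔ W ⊆ `F Y □₀` (the cubes of □₀∖□̃⁴), j ≤ k, □′ ∈ `Sq Y □₀ j` (the cubes of π_j in □̃², NOW PER □₀),
X ∈ `SX Y □₀ j □′` ⊆ the 𝐃_j-domains containing □′ (`hSX`; print: X ⊂ □̃²) — plus the Y-sum of the (I.3.7)-type terms
over □ ∈ `Sc Y`, j ≤ k, □′ ∈ `Sq' Y □ j`, X ∈ `SX' Y □ j □′` ⊆ the X ∋ □′ (`hSX'`) with X₀ ⊆ Y (`hX0`; X₀ = the
π_k-blocks met by X = `X.image (tcoarse L^{k−j})`, p. 8) (`h133`); (b) per-term analyticity on (1.34) (pp. 7, 9) and the closure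
of `W.Analytic` under finite sums ([folklore]); (c) **(1.24)** per term (`h124`, N = M⁻⁴|Y₀∖□̃⁴|) and **(1.30)** per
term (`h130`, with M⁻⁴|Y∖X₀| = #(Y∖X₀) and dist^{(ξ)}(□′, □) = `dist`) VERBATIM, by reference in print to (I.3.54),
(I.3.17), [15] Prop. 4, [13] (3.108); (d) the □₀-data of [I]'s block geometry (`hblk`, `hNblk`, `hN`, `hF`, `hS0`);
(e) «(6L)⁴L^jη» per □₀ (`hq`), the scale-honest □′-sum ≤ O₂·(L^jη)⁻⁴ (`hq'`), #{□} ≤ M⁻⁴|Y| (`hSc`); (f) thresholds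
κ, δκ ≥ κ₀(64, 8), κ₁ ≥ 1 + 2 log(8·12³), κ₁ ≥ 2 + 16 log 128, δ₀M ≥ 10e⁻¹, δκ ≥ 1, L ≥ 2, 0 ≤ κ, δ < 1; R8, R9;
(g) the choice of the constants of (1.36), P₁ + P₂ ≤ E₀ε₁C₁M^q e^{C₂κ₁} with P₁ = K·K₀·2(6L)⁴·e·e^{⅛κ₁d₀},
P₂ = 2·64K′·K₀·O₂ (`hC`).  Everything geometric — G1, (1.25), (1.26) at κ and δκ, (1.27), (1.28) outer, (1.29),
(1.31), G1′, (1.32), (L^jη)⁵, the j-sums, the □-count, the p. 9 gathering — is PROVED (kernel: `gather_129_dep`,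
`gather_p9_dep`, `B13Lemma1Torus`, `B13Lemma1TorusFull.ineq131_torus`, `TreeLengthTorus.ineq126_torus`,
`B13Sect1Arith`, `B13Lemma1Assembly.lemma1Printed_of_129`). [cite: Balaban1988RG2Cluster, Lemma 1 pp.7–9] -/
theorem lemma1Printed_twoTorus_dep (W : TwoTorusStep 4 L N') (c : B13.Consts) (k : ℕ) {α C α' : Type*}
    (S0 : TDom 4 (L * N') → Finset α) (blk : TDom 4 (L * N') → α → Finset (TPt 4 (L * N')))
    (F : TDom 4 (L * N') → α → Finset C)
    (Sq : TDom 4 (L * N') → α → (j : ℕ) → Finset (TPt 4 (L ^ (k - j) * (L * N'))))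
    (SX : TDom 4 (L * N') → α → (j : ℕ) → TPt 4 (L ^ (k - j) * (L * N')) →
      Finset (TDom 4 (L ^ (k - j) * (L * N'))))
    (T : TDom 4 (L * N') → α → Finset C → (j : ℕ) → TPt 4 (L ^ (k - j) * (L * N')) →
      TDom 4 (L ^ (k - j) * (L * N')) → W.Φ → ℂ)
    (N : TDom 4 (L * N') → α → Finset C → ℝ)
    (Sc : TDom 4 (L * N') → Finset α')
    (Sq' : TDom 4 (L * N') → α' → (j : ℕ) → Finset (TPt 4 (L ^ (k - j) * (L * N'))))
    (SX' : TDom 4 (L * N') → α' → (j : ℕ) → TPt 4 (L ^ (k - j) * (L * N')) →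
      Finset (TDom 4 (L ^ (k - j) * (L * N'))))
    (T' : TDom 4 (L * N') → α' → (j : ℕ) → TPt 4 (L ^ (k - j) * (L * N')) →
      TDom 4 (L ^ (k - j) * (L * N')) → W.Φ → ℂ)
    (dist : TDom 4 (L * N') → α' → (j : ℕ) → TPt 4 (L ^ (k - j) * (L * N')) → ℝ) {K d0 K' O₂ : ℝ}
    (h133 : ∀ Y, W.Vp Y =
      (∑ a ∈ S0 Y, ∑ X ∈ (F Y a).powerset, ∑ j ∈ Finset.range (k + 1), ∑ q ∈ Sq Y a j,
        ∑ x ∈ SX Y a j q, T Y a X j q x) +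
      (∑ a ∈ Sc Y, ∑ j ∈ Finset.range (k + 1), ∑ q ∈ Sq' Y a j, ∑ x ∈ SX' Y a j q, T' Y a j q x))
    (hSX : ∀ Y a j q, SX Y a j q ⊆ (tcubeSys 4 (L ^ (k - j) * (L * N'))).above q)
    (hSX' : ∀ Y a j q, SX' Y a j q ⊆ (tcubeSys 4 (L ^ (k - j) * (L * N'))).above q)
    (hX0 : ∀ Y, ∀ a ∈ Sc Y, ∀ j ∈ Finset.range (k + 1), ∀ q ∈ Sq' Y a j, ∀ x ∈ SX' Y a j q,
      x.1.image (tcoarse (L ^ (k - j)) (L * N')) ⊆ Y.1)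
    (hAdd : ∀ (s : Set W.Φ) (f g : W.Φ → ℂ), W.Analytic f s → W.Analytic g s → W.Analytic (f + g) s)
    (hZero : ∀ s : Set W.Φ, W.Analytic 0 s)
    (hAnT : ∀ Y, ∀ a ∈ S0 Y, ∀ X ∈ (F Y a).powerset, ∀ j ∈ Finset.range (k + 1), ∀ q ∈ Sq Y a j,
      ∀ x ∈ SX Y a j q, W.Analytic (T Y a X j q x) (W.sp1 Y))
    (hAnT' : ∀ Y, ∀ a ∈ Sc Y, ∀ j ∈ Finset.range (k + 1), ∀ q ∈ Sq' Y a j, ∀ x ∈ SX' Y a j q,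
      W.Analytic (T' Y a j q x) (W.sp1 Y))
    (hK : 0 ≤ K) (hd0 : 0 ≤ d0) (hK' : 0 ≤ K') (hO₂ : 0 ≤ O₂)
    (hL : 2 ≤ L) (hκ : 0 ≤ c.κ) (hδ1 : c.δ < 1) (hδκ : 1 ≤ c.δ * c.κ)
    (hκ126 : kappa₀ 64 8 ≤ c.κ) (hκ126' : kappa₀ 64 8 ≤ c.δ * c.κ)
    (hκ₁ : 1 + 2 * Real.log (8 * 12 ^ 3) ≤ c.κ₁) (hκ₁' : 2 + 16 * Real.log 128 ≤ c.κ₁)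
    (hδ₀M : 10 * Real.exp (-1) ≤ c.δ₀ * c.M) (hR8 : (1 - c.δ) * c.κ ≤ (1 / 4) * (c.κ₁ - 1))
    (hR9 : (1 - 2 * c.δ) * c.κ ≤ (1 / 16) * c.κ₁)
    (h124 : ∀ Y φ, φ ∈ W.sp1 Y → ∀ a ∈ S0 Y, ∀ X ∈ (F Y a).powerset, ∀ j ∈ Finset.range (k + 1), ∀ q ∈ Sq Y a j,
      ∀ x ∈ SX Y a j q,
        ‖T Y a X j q x φ‖ ≤ K * ((L : ℝ) ^ j * ((L : ℝ) ^ k)⁻¹) ^ 5 *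
          Real.exp (-(c.κ₁ - 1) * N Y a X) * Real.exp (-(c.κ * torusTreeLen x.1)))
    (hblk : ∀ Y, ∀ a ∈ S0 Y, blk Y a ⊆ Y.1 ∧ IsTDom (blk Y a) ∧ torusTreeLen (blk Y a) ≤ d0 ∧
      (5 : ℝ) * 2 ^ 4 ≤ (blk Y a).card)
    (hNblk : ∀ Y, ∀ a ∈ S0 Y, ∀ X ∈ (F Y a).powerset, ((Y.1 \ blk Y a).card : ℝ) ≤ N Y a X)
    (hN : ∀ Y a, ∀ X ∈ (F Y a).powerset, (X.card : ℝ) ≤ N Y a X)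
    (hF : ∀ Y a, ((F Y a).card : ℝ) ≤ 8 * 12 ^ 3)
    (hS0 : ∀ Y, (S0 Y).card ≤ Y.1.card)
    (hq : ∀ Y, ∀ a ∈ S0 Y, ∀ j ∈ Finset.range (k + 1),
      ((Sq Y a j).card : ℝ) * ((L : ℝ) ^ j * ((L : ℝ) ^ k)⁻¹) ^ 5 ≤
        (6 * (L : ℝ)) ^ 4 * ((L : ℝ) ^ j * ((L : ℝ) ^ k)⁻¹))
    (h130 : ∀ Y φ, φ ∈ W.sp1 Y → ∀ a ∈ Sc Y, ∀ j ∈ Finset.range (k + 1), ∀ q ∈ Sq' Y a j,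
      ∀ x ∈ SX' Y a j q,
        ‖T' Y a j q x φ‖ ≤ K' * Real.exp (-(1 / 2) * (c.δ₀ * c.M) * ((L : ℝ) ^ j * ((L : ℝ) ^ k)⁻¹)⁻¹
            - (1 / 2) * c.δ₀ * dist Y a j q) *
          Real.exp (-(c.κ₁ - 1) * ((Y.1 \ x.1.image (tcoarse (L ^ (k - j)) (L * N'))).card : ℝ)) *
          Real.exp (-(c.κ * torusTreeLen x.1)))
    (hq' : ∀ Y, ∀ a ∈ Sc Y, ∀ j ∈ Finset.range (k + 1),
      ∑ q ∈ Sq' Y a j, Real.exp (-((1 / 2) * c.δ₀ * dist Y a j q)) ≤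
        O₂ * (((L : ℝ) ^ j * ((L : ℝ) ^ k)⁻¹) ^ 4)⁻¹)
    (hSc : ∀ Y, (Sc Y).card ≤ Y.1.card)
    (hC : K * K₀ 64 8 * (2 * (6 * (L : ℝ)) ^ 4) * Real.exp 1 * Real.exp ((1 / 8) * c.κ₁ * d0) +
        2 * (64 * K') * K₀ 64 8 * O₂ ≤
      c.E₀ * c.ε₁ * c.C₁ * c.M ^ c.q * Real.exp (c.C₂ * c.κ₁)) :
    B13.Lemma1Printed W.toStepData c := by
  -- abbreviations and elementary facts
  set ℓ : ℕ → ℝ := fun j => (L : ℝ) ^ j * ((L : ℝ) ^ k)⁻¹ with hℓdef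
  have hLr : (2 : ℝ) ≤ (L : ℝ) := by exact_mod_cast hL
  have hL0 : (0 : ℝ) < (L : ℝ) := by linarith
  have hL1 : (1 : ℝ) ≤ (L : ℝ) := by linarith
  have hLk : (0 : ℝ) < (L : ℝ) ^ k := by positivity
  have hℓ : ∀ j, 0 ≤ ℓ j := fun j => by positivity
  have hℓ1 : ∀ j ∈ Finset.range (k + 1), ℓ j ≤ 1 := by
    intro j hj
    have hjk : j ≤ k := Nat.lt_succ_iff.mp (Finset.mem_range.mp hj)
    show (L : ℝ) ^ j * ((L : ℝ) ^ k)⁻¹ ≤ 1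
    rw [mul_inv_le_iff₀ hLk, one_mul]
    exact pow_le_pow_right₀ hL1 hjk
  have hO1 : (0 : ℝ) ≤ K₀ 64 8 := (K₀_pos _ _).le
  have hκ1 : 1 ≤ c.κ₁ := by
    have : 0 ≤ Real.log (8 * 12 ^ 3) := Real.log_nonneg (by norm_num)
    linarith
  /- CHAIN 1: the terms (1.23) of (I.3.34)/(I.3.21) type -/
  -- G1 on the torus: d_k(Y) ≤ d_k(□₀) + 4M⁻⁴|Y₀∖□̃⁴|
  have hG1 : ∀ Y : TDom 4 (L * N'), ∀ a ∈ S0 Y, ∀ X ∈ (F Y a).powerset,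
      torusTreeLen Y.1 ≤ d0 + 4 * N Y a X := by
    intro Y a ha X hX
    obtain ⟨hsub, hdom, hlen, -⟩ := hblk Y a ha
    exact g1_torus hdom Y.2.2 hsub hlen (hNblk Y a ha X hX)
  -- the outer inequality of (1.28) on the torus
  have h128 : ∀ Y : TDom 4 (L * N'),
      ((S0 Y).card : ℝ) ≤ Real.exp ((1 / 16) * (c.κ₁ - 2) * torusTreeLen Y.1) := by
    intro Y
    refine outer128_torus (d := 4) Y.2.1 Y.2.2 (hS0 Y) (fun hpos => ?_) (by norm_num; exact hκ₁')
    obtain ⟨a, ha⟩ := Finset.card_pos.mp hpos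
    obtain ⟨hsub, -, -, hbig⟩ := hblk Y a ha
    exact hbig.trans (by exact_mod_cast Finset.card_le_card hsub)
  -- the bound on the first Y-sum, as a function on the space (1.34)
  have hW₁ : ∀ Y φ, φ ∈ W.sp1 Y →
      ‖(∑ a ∈ S0 Y, ∑ X ∈ (F Y a).powerset, ∑ j ∈ Finset.range (k + 1), ∑ q ∈ Sq Y a j,
          ∑ x ∈ SX Y a j q, T Y a X j q x) φ‖
        ≤ K * K₀ 64 8 * (2 * (6 * (L : ℝ)) ^ 4) * Real.exp 1 * Real.exp ((1 / 8) * c.κ₁ * d0) *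
          Real.exp (-(1 / 16) * c.κ₁ * torusTreeLen Y.1) := by
    intro Y φ hφ
    -- (1.24) ⇒ the (1.25)-form per-term bound
    have hT : ∀ a ∈ S0 Y, ∀ X ∈ (F Y a).powerset, ∀ j ∈ Finset.range (k + 1), ∀ q ∈ Sq Y a j,
        ∀ x ∈ SX Y a j q,
          ‖T Y a X j q x φ‖ ≤ K * ℓ j ^ 5 * Real.exp (-(c.κ * torusTreeLen x.1)) *
            Real.exp (-(1 / 8) * (c.κ₁ - 1) * torusTreeLen Y.1 + (1 / 8) * c.κ₁ * d0
              - (1 / 2) * (c.κ₁ - 1) * N Y a X) := by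
      intro a ha X hX j hj q hq₀ x hx
      have h := h124 Y φ hφ a ha X hX j hj q hq₀ x hx
      have h125 := B13Sect1Arith.bound_125 hκ1 hd0 (hG1 Y a ha X hX)
      calc ‖T Y a X j q x φ‖
          ≤ K * ℓ j ^ 5 * Real.exp (-(c.κ₁ - 1) * N Y a X) * Real.exp (-(c.κ * torusTreeLen x.1)) := h
        _ = K * ℓ j ^ 5 * Real.exp (-(c.κ * torusTreeLen x.1)) * Real.exp (-(c.κ₁ - 1) * N Y a X) := by ring
        _ ≤ _ := mul_le_mul_of_nonneg_left h125 (by positivity)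
    -- (1.26) at the rate κ at every scale of the tower (PROVED), «2(6L)⁴», (1.27)
    have h126 : ∀ a ∈ S0 Y, ∀ j ∈ Finset.range (k + 1), ∀ q ∈ Sq Y a j,
        ∑ x ∈ SX Y a j q, Real.exp (-(c.κ * torusTreeLen x.1)) ≤ K₀ 64 8 :=
      fun a _ j _ q _ => sum_exp_sub_le (L ^ (k - j) * (L * N')) hκ126 q (hSX Y a j q)
    have hj : ∑ j ∈ Finset.range (k + 1), (6 * (L : ℝ)) ^ 4 * ℓ j ≤ 2 * (6 * (L : ℝ)) ^ 4 :=
      B13Sect1Arith.jsum_le hLr k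
    have hY : ∀ a ∈ S0 Y, ∑ X ∈ (F Y a).powerset, Real.exp (-(1 / 2) * (c.κ₁ - 1) * N Y a X) ≤ Real.exp 1 :=
      fun a _ => B13Lemma1Assembly.sumY0_127 (F Y a) (hF Y a) (N Y a) (hN Y a) hκ₁
    have hgather := gather_129_dep (S0 Y) (fun a => (F Y a).powerset) k (Sq Y) (SX Y)
      (fun a X j q x => ‖T Y a X j q x φ‖) ℓ
      (fun _ _ _ x => torusTreeLen x.1) (N Y) (L := (L : ℝ)) (d := torusTreeLen Y.1) (d0 := d0) (κ := c.κ)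
      (κ₁ := c.κ₁) hK hO1 hℓ hT h126 (hq Y) hj hY (h128 Y)
    refine le_trans ?_ hgather
    simp only [Finset.sum_apply]
    refine (norm_sum_le _ _).trans (Finset.sum_le_sum fun a _ => ?_)
    refine (norm_sum_le _ _).trans (Finset.sum_le_sum fun X _ => ?_)
    refine (norm_sum_le _ _).trans (Finset.sum_le_sum fun j _ => ?_)
    refine (norm_sum_le _ _).trans (Finset.sum_le_sum fun q _ => ?_)
    exact norm_sum_le _ _
  /- CHAIN 2: the (I.3.7)-type terms -/
  have hW₂ : ∀ Y φ, φ ∈ W.sp1 Y →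
      ‖(∑ a ∈ Sc Y, ∑ j ∈ Finset.range (k + 1), ∑ q ∈ Sq' Y a j, ∑ x ∈ SX' Y a j q, T' Y a j q x) φ‖
        ≤ 2 * (64 * K') * K₀ 64 8 * O₂ * Real.exp (-(1 - 2 * c.δ) * c.κ * torusTreeLen Y.1) := by
    intro Y φ hφ
    -- (1.30) + (1.31) [PROVED] + G1′ [PROVED] ⇒ the (1.32)-form per-term bound
    have hT : ∀ a ∈ Sc Y, ∀ j ∈ Finset.range (k + 1), ∀ q ∈ Sq' Y a j, ∀ x ∈ SX' Y a j q,
          ‖T' Y a j q x φ‖ ≤ K' * Real.exp (-(1 / 2) * (c.δ₀ * c.M) * ((L : ℝ) ^ j * ((L : ℝ) ^ k)⁻¹)⁻¹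
              - (1 / 2) * c.δ₀ * dist Y a j q) *
            Real.exp (-(1 - c.δ) * c.κ * torusTreeLen Y.1 - c.δ * c.κ * torusTreeLen x.1) := by
      intro a ha j hj q hq₀ x hx
      have hjk : j ≤ k := Nat.lt_succ_iff.mp (Finset.mem_range.mp hj)
      have hsub := hX0 Y a ha j hj q hq₀ x hx
      have hdom : IsTDom (x.1.image (tcoarse (L ^ (k - j)) (L * N'))) :=
        isTDom_image_tcoarse (L ^ (k - j)) (L * N') x.2
      have h131 : torusTreeLen (x.1.image (tcoarse (L ^ (k - j)) (L * N'))) ≤ ℓ j * torusTreeLen x.1 :=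
        ineq131_torus L (L * N') k j hjk x.2
      have hG1' : torusTreeLen Y.1 ≤ torusTreeLen (x.1.image (tcoarse (L ^ (k - j)) (L * N'))) +
          4 * ((Y.1 \ x.1.image (tcoarse (L ^ (k - j)) (L * N'))).card : ℝ) :=
        g1_torus hdom Y.2.2 hsub le_rfl le_rfl
      have h132 := B13Sect1Arith.bound_132
        (n := ((Y.1 \ x.1.image (tcoarse (L ^ (k - j)) (L * N'))).card : ℝ)) hκ hδ1 hR8 (hℓ1 j hj)
        (torusTreeLen_nonneg x.1) h131 (Nat.cast_nonneg _) hG1'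
      calc ‖T' Y a j q x φ‖ ≤ _ := h130 Y φ hφ a ha j hj q hq₀ x hx
        _ = K' * Real.exp (-(1 / 2) * (c.δ₀ * c.M) * ((L : ℝ) ^ j * ((L : ℝ) ^ k)⁻¹)⁻¹
              - (1 / 2) * c.δ₀ * dist Y a j q) *
            (Real.exp (-(c.κ₁ - 1) * ((Y.1 \ x.1.image (tcoarse (L ^ (k - j)) (L * N'))).card : ℝ)) *
              Real.exp (-(c.κ * torusTreeLen x.1))) := by ring
        _ ≤ _ := mul_le_mul_of_nonneg_left h132 (by positivity)
    -- (1.26) at the rate δκ over the sub-families (PROVED) and the repaired □-count 64e^{δκd_k(Y)} (PROVED)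
    have h126' : ∀ a ∈ Sc Y, ∀ j ∈ Finset.range (k + 1), ∀ q ∈ Sq' Y a j,
        ∑ x ∈ SX' Y a j q, Real.exp (-(c.δ * c.κ * torusTreeLen x.1)) ≤ K₀ 64 8 :=
      fun a _ j _ q _ => sum_exp_sub_le (L ^ (k - j) * (L * N')) hκ126' q (hSX' Y a j q)
    have hcnt : ((Sc Y).card : ℝ) ≤ 64 * Real.exp (c.δ * c.κ * torusTreeLen Y.1) := by
      have h := card_le_mul_exp_torus (d := 4) Y.2.1 Y.2.2 hδκ
      have h' : ((Sc Y).card : ℝ) ≤ Y.1.card := by exact_mod_cast hSc Y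
      norm_num at h
      linarith
    have hgather := gather_p9_dep (Sc Y) k (Sq' Y) (SX' Y) (fun a j q x => ‖T' Y a j q x φ‖) (dist Y) (fun _ _ _ x => torusTreeLen x.1) (L := (L : ℝ))
      (d := torusTreeLen Y.1) (κ := c.κ) hK' hO1 hO₂ hLr hδ₀M hT h126' (hq' Y) hcnt
    have hfinal : 2 * K' * K₀ 64 8 * O₂ * (64 * Real.exp (c.δ * c.κ * torusTreeLen Y.1)) *
        Real.exp (-(1 - c.δ) * c.κ * torusTreeLen Y.1)
          = 2 * (64 * K') * K₀ 64 8 * O₂ * Real.exp (-(1 - 2 * c.δ) * c.κ * torusTreeLen Y.1) := by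
      have e : Real.exp (c.δ * c.κ * torusTreeLen Y.1) * Real.exp (-(1 - c.δ) * c.κ * torusTreeLen Y.1)
          = Real.exp (-(1 - 2 * c.δ) * c.κ * torusTreeLen Y.1) := by
        rw [← Real.exp_add]; ring_nf
      calc _ = 2 * (64 * K') * K₀ 64 8 * O₂ * (Real.exp (c.δ * c.κ * torusTreeLen Y.1) *
            Real.exp (-(1 - c.δ) * c.κ * torusTreeLen Y.1)) := by ring
        _ = _ := by rw [e]
    rw [← hfinal]
    refine le_trans ?_ hgather
    simp only [Finset.sum_apply]
    refine (norm_sum_le _ _).trans (Finset.sum_le_sum fun a _ => ?_)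
    refine (norm_sum_le _ _).trans (Finset.sum_le_sum fun j _ => ?_)
    refine (norm_sum_le _ _).trans (Finset.sum_le_sum fun q _ => ?_)
    exact norm_sum_le _ _
  /- analyticity of the two Y-sums (closure under finite sums) and the p. 9 conclusion -/
  have hAn₁ : ∀ Y, W.Analytic (∑ a ∈ S0 Y, ∑ X ∈ (F Y a).powerset, ∑ j ∈ Finset.range (k + 1), ∑ q ∈ Sq Y a j,
      ∑ x ∈ SX Y a j q, T Y a X j q x) (W.sp1 Y) := by
    intro Y
    refine analytic_finset_sum W.Analytic (W.sp1 Y) (hAdd _) (hZero _) _ _ fun a ha => ?_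
    refine analytic_finset_sum W.Analytic (W.sp1 Y) (hAdd _) (hZero _) _ _ fun X hX => ?_
    refine analytic_finset_sum W.Analytic (W.sp1 Y) (hAdd _) (hZero _) _ _ fun j hj => ?_
    refine analytic_finset_sum W.Analytic (W.sp1 Y) (hAdd _) (hZero _) _ _ fun q hq₀ => ?_
    exact analytic_finset_sum W.Analytic (W.sp1 Y) (hAdd _) (hZero _) _ _ fun x hx =>
      hAnT Y a ha X hX j hj q hq₀ x hx
  have hAn₂ : ∀ Y, W.Analytic (∑ a ∈ Sc Y, ∑ j ∈ Finset.range (k + 1), ∑ q ∈ Sq' Y a j,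
      ∑ x ∈ SX' Y a j q, T' Y a j q x) (W.sp1 Y) := by
    intro Y
    refine analytic_finset_sum W.Analytic (W.sp1 Y) (hAdd _) (hZero _) _ _ fun a ha => ?_
    refine analytic_finset_sum W.Analytic (W.sp1 Y) (hAdd _) (hZero _) _ _ fun j hj => ?_
    refine analytic_finset_sum W.Analytic (W.sp1 Y) (hAdd _) (hZero _) _ _ fun q hq₀ => ?_
    exact analytic_finset_sum W.Analytic (W.sp1 Y) (hAdd _) (hZero _) _ _ fun x hx =>
      hAnT' Y a ha j hj q hq₀ x hx
  have hP₁ : 0 ≤ K * K₀ 64 8 * (2 * (6 * (L : ℝ)) ^ 4) * Real.exp 1 * Real.exp ((1 / 8) * c.κ₁ * d0) := by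
    positivity
  exact B13Lemma1Assembly.lemma1Printed_of_129 W.toStepData c _ _ hP₁ h133 hAdd hAn₁ hAn₂ hW₁ hW₂ hR9 hC

end Torus

end Literature.MathematicalPhysics.QuantumFieldTheory.Balaban1983to89.B13Lemma1DepTorus
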